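import Literature.AlgebraicGeometry.Resolution.RationalFunctionFieldDensity
import Literature.AlgebraicGeometry.Resolution.SubfieldTransport
import Literature.AlgebraicGeometry.Resolution.NormalDegreePDefectlessVTGaloisProofs
import Mathlib.FieldTheory.PurelyInseparable.PerfectClosure
import HarnessLib

/-!
# Kuhlmann 2010, Thm. 1.1, "separably defectless" clause for `K(x)`, `x` value-transcendental over a separably closed `K`: reduction to (R2)

Topic: `Literature/AlgebraicGeometry/Resolution` (valued function fields). Proof layer for the
named fact `Kuhlmann2010SeparablyDefectlessRational_sepClosed`
(`Kuhlmann2019HenselianRationalitySteps.lean`) = F.-V. Kuhlmann, *Elimination of ramification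
I: The generalized stability theorem*, Trans. AMS 362 (2010) = arXiv:1003.5678, **Thm. 1.1,
the "separably defectless" clause** ("If `vK` is cofinal in `vF`, then it also holds for
'separably defectless' in the place of 'defectless'") for `F = K(x)` with `x`
value-transcendental over a separably closed `K`, as quoted by Kuhlmann 2019, proof of
Prop. 5.7.

The printed proof (§5, p. 20: "Then the completion `F^c` of `(F,v)` contains the completion
`K^c` of `(K,v)`. A valued field is separably defectless if and only if its completion is
defectless (cf. [K6]). Hence, `K^c` is a defectless field. We consider the subfield
`F.K^c ⊂ F^c` … By the 'defectless' version of Theorem 1.1 it follows that `(K^c.F,v)` is a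
defectless field. Hence also its completion `(F^c,v)` is defectless. By the above cited theorem
it follows that `(F,v)` is [separably] defectless") is followed with the completion `K^c`
replaced by the algebraic closure `K'` of `K` inside an algebraic closure `Ω̄ ⊇ Ω` — a purely
inseparable extension of the separably closed `K` in which `K` is DENSE
(`SeparablyClosedDensity.lean`; the valuation is non-trivial on `K`, for otherwise the
cofinality hypothesis would force `v(x) = 1`) —, so that `K(x)` is dense in `K'(x)`
(`RationalFunctionFieldDensity.lean`), `(K'(x), v)` is a defectless field by the "defectless"
version of Thm. 1.1 for `K'(x)` over the algebraically closed `K'` ((R2),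
`Kuhlmann2010StabilityAlgClosedValueTranscendental`, `GeneralizedStabilityTrdegOne.lean`), and
separable defectlessness descends from `K'(x)` to the dense subfield `K(x)` with `K'(x)|K(x)`
purely inseparable (`IsSeparablyDefectlessField.of_isDenseIn`,
`SeparablyDefectlessDenseDescent.lean` — the finite-level content of "[K6]").

## Content (PROVED)

* `IsSeparablyDefectlessField.congr` — separable defectlessness is invariant under isomorphisms
  of valued fields (as `IsDefectlessField.congr`, `DefectTransport.lean`).
* `Kuhlmann2010SeparablyDefectlessRational_sepClosed.of_algClosedVT` —
  `Kuhlmann2010StabilityAlgClosedValueTranscendental → Kuhlmann2010SeparablyDefectlessRational_sepClosed`.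
* `Kuhlmann2010SeparablyDefectlessRational_sepClosed.of_rankOne` — hence from the two rank-one
  cases of (R4) (`Kuhlmann2010StabilityAlgClosedValueTranscendental.of_rankOne'`,
  `GeneralizedStabilityReductionProofs.lean`), of which the value-transcendental one is
  discharged (`Kuhlmann2010StabilityRankOneValueTranscendental_holds`): the fact rests on
  `Kuhlmann2010StabilityRankOneResidueTranscendental` alone.

## Sources

* F.-V. Kuhlmann, Trans. AMS 362 (2010) = arXiv:1003.5678: Thm. 1.1, §5 (p. 20, the
  "separably defectless" clause; Lemmas 5.2–5.4). [Kuhlmann2010]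
* F.-V. Kuhlmann, Israel J. Math. 234 (2019) = arXiv:1701.05508, proof of Prop. 5.7 (the use).
  [Kuhlmann2019]
-/

noncomputable section

open IsLocalRing Polynomial

namespace Literature.AlgebraicGeometry.Resolution

universe u

/-! ### Transport of separable defectlessness -/

/-- **A separably defectless field stays separably defectless under an isomorphism of valued
fields** `φ : (E₁, O₁) ≃ (E₂, O₂)` (`O₁ = φ⁻¹(O₂)`). [folklore] -/
theorem IsSeparablyDefectlessField.congr {E₁ E₂ : Type u} [Field E₁] [Field E₂] (φ : E₁ ≃+* E₂)
    {O₁ : ValuationSubring E₁} {O₂ : ValuationSubring E₂} (hO : O₁ = O₂.comap φ.toRingHom)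
    (h : IsSeparablyDefectlessField E₁ O₁) : IsSeparablyDefectlessField E₂ O₂ := by
  intro L _ _ hfin hsep
  letI alg₁ : Algebra E₁ L := ((algebraMap E₂ L).comp φ.toRingHom).toAlgebra
  have hcomp : (algebraMap E₂ L).comp φ.toRingHom = (RingEquiv.refl L).toRingHom.comp (algebraMap E₁ L) :=
    RingHom.ext fun _ => rfl
  haveI : FiniteDimensional E₁ L := by
    haveI := hfin
    exact Module.Finite.of_equiv_equiv (A₁ := E₂) (B₁ := L) (A₂ := E₁) (B₂ := L) φ.symm
      (RingEquiv.refl L) (by ext c; change algebraMap E₂ L (φ (φ.symm c)) = algebraMap E₂ L c; simp)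
  haveI : Algebra.IsSeparable E₁ L := by
    haveI := hsep
    exact Algebra.IsSeparable.of_equiv_equiv (A₁ := E₂) (B₁ := L) (A₂ := E₁) (B₂ := L) φ.symm
      (RingEquiv.refl L) (by ext c; change algebraMap E₂ L (φ (φ.symm c)) = algebraMap E₂ L c; simp)
  have h₁ : IsDefectlessIn E₁ O₁ L := h L inferInstance inferInstance
  exact IsDefectlessIn.congr (L₁ := L) (L₂ := L) φ (RingEquiv.refl L) (fun x => rfl) hO h₁

/-! ### The reduction -/

/-- **Kuhlmann 2010, Thm. 1.1, "separably defectless" clause for `K(x)` (`x`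
value-transcendental, `K` separably closed), from (R2) for `K'(x)` over the algebraically closed
`K' = K̃`** (`Kuhlmann2010StabilityAlgClosedValueTranscendental`). PROVED along the printed proof
(§5, p. 20) with the completion replaced by the algebraic closure of `K`, in which `K` is dense:
`K(x)` is dense in `K'(x)`, `K'(x)|K(x)` is purely inseparable, `(K'(x), v)` is defectless by
(R2), and separable defectlessness descends to dense subfields of purely inseparable
extensions. [cite: Kuhlmann2010, Thm. 1.1 and Section 5 (p. 20)] -/
theorem Kuhlmann2010SeparablyDefectlessRational_sepClosed.of_algClosedVT
    (hB : Kuhlmann2010StabilityAlgClosedValueTranscendental.{u}) :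
    Kuhlmann2010SeparablyDefectlessRational_sepClosed.{u} := by
  intro Ω _ V K x hK x_vt hcof
  classical
  haveI := hK
  set E : Subfield Ω := Subfield.closure ((K : Set Ω) ∪ {x}) with hE
  have hxE : x ∈ E := Subfield.subset_closure (Or.inr rfl)
  have hx0 : x ≠ 0 := x_vt.ne_zero
  -- Step 1: the valuation is non-trivial on `K`
  obtain ⟨π, hπK, hπ0, hπ1⟩ : ∃ π ∈ K, π ≠ 0 ∧ V.valuation π < 1 := by
    by_contra hno
    push Not at hno
    -- every `a ∈ K^×` has value `1`
    have h1 : ∀ a ∈ K, a ≠ 0 → V.valuation a = 1 := by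
      intro a ha ha0
      refine le_antisymm ?_ (hno a ha ha0)
      have h := hno a⁻¹ (inv_mem ha) (inv_ne_zero ha0)
      rw [map_inv₀, one_le_inv₀ ((Valuation.pos_iff _).mpr ha0)] at h
      exact h
    obtain ⟨b, hbK, hb0, hb⟩ := hcof x hxE hx0
    obtain ⟨b', hb'K, hb'0, hb'⟩ := hcof x⁻¹ (inv_mem hxE) (inv_ne_zero hx0)
    rw [h1 b hbK hb0] at hb
    rw [h1 b' hb'K hb'0, map_inv₀, one_le_inv₀ ((Valuation.pos_iff _).mpr hx0)] at hb'
    exact x_vt.valuation_ne_one (le_antisymm hb' hb)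
  -- Step 2: embed into an algebraic closure `Ω'` of `Ω` and extend `V`
  let Ω' : Type u := AlgebraicClosure Ω
  let ι : Ω →+* Ω' := algebraMap Ω Ω'
  obtain ⟨V', hV'⟩ := exists_valuationSubring_comap_eq (Ω := Ω') V
  set K₁ : Subfield Ω' := K.map ι with hK₁
  set x₁ : Ω' := ι x with hx₁def
  have hE₁ : E.map ι = Subfield.closure ((K₁ : Set Ω') ∪ {x₁}) := by
    rw [hE, map_closure_union, Set.image_singleton]
  haveI : IsSepClosed K₁ := isSepClosed_map ι K
  have hx₁ : IsValueTranscendentalOver V' K₁ x₁ := by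
    intro n hn c hc h
    obtain ⟨c₀, hc₀K, rfl⟩ := Subfield.mem_map.mp hc
    refine x_vt n hn c₀ hc₀K ?_
    rw [← map_pow] at h ⊢
    rw [hx₁def, ← map_pow] at h
    exact (valuation_map_eq_iff ι hV' _ _).mp h
  have hcof₁ : IsValueCofinal V' K₁ (E.map ι) := by
    intro a ha ha0
    obtain ⟨a₀, ha₀E, rfl⟩ := Subfield.mem_map.mp ha
    have ha₀0 : a₀ ≠ 0 := fun h => ha0 (by rw [h, map_zero])
    obtain ⟨b, hbK, hb0, hb⟩ := hcof a₀ ha₀E ha₀0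
    refine ⟨ι b, Subfield.mem_map.mpr ⟨b, hbK, rfl⟩, (map_ne_zero ι).mpr hb0, ?_⟩
    have := ((isEquiv_valuation_comap ι hV') b a₀).mpr hb
    simpa only [Valuation.comap_apply] using this
  have hπ₁K : ι π ∈ K₁ := Subfield.mem_map.mpr ⟨π, hπK, rfl⟩
  have hπ₁0 : ι π ≠ 0 := (map_ne_zero ι).mpr hπ0
  have hπ₁ : V'.valuation (ι π) < 1 := (valuation_map_lt_one_iff ι hV' π).mpr hπ1
  -- Step 3: `K'` = the algebraic closure of `K₁` in `Ω'`: algebraically closed, purely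
  -- inseparable over `K₁`, and `K₁` is dense in it
  set Kt : IntermediateField K₁ Ω' := algebraicClosure K₁ Ω' with hKt
  haveI : IsAlgClosed Kt := IsAlgClosure.isAlgClosed K₁
  set K' : Subfield Ω' := Kt.toSubfield with hK'
  have hKK' : K₁ ≤ K' := fun c hc => by
    have : (algebraMap K₁ Ω') ⟨c, hc⟩ ∈ Kt := Kt.algebraMap_mem ⟨c, hc⟩
    exact this
  have hpi : ∀ y ∈ K', ∃ n : ℕ, y ^ (ringExpChar Ω') ^ n ∈ K₁ := fun y hy =>
    exists_pow_ringExpChar_mem_of_isAlgebraic K₁ (mem_algebraicClosure_iff.mp hy)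
  have hdense : IsDenseIn V' K₁ K' := isDenseIn_of_isSepClosed_of_pow_mem V' K₁ K' hπ₁K hπ₁0 hπ₁ hpi
  have hx' : IsValueTranscendentalOver V' K' x₁ := hx₁.of_pow_mem hpi
  set E' : Subfield Ω' := Subfield.closure ((K' : Set Ω') ∪ {x₁}) with hE'
  have hcof₁' : IsValueCofinal V' K₁ (Subfield.closure ((K₁ : Set Ω') ∪ {x₁})) := by
    rw [← hE₁]; exact hcof₁
  have hdenseE : IsDenseIn V' (E.map ι) E' := by
    rw [hE₁]
    exact isDenseIn_closure_insert V' x₁ hdense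
      (coinitial_closure_insert_of_isValueTranscendentalOver hKK' hx' hcof₁')
  have hEE' : E.map ι ≤ E' := by
    rw [hE₁]
    exact Subfield.closure_mono (Set.union_subset_union_left _ hKK')
  -- Step 4: `(K'(x), v)` is a defectless field, by (R2) over the algebraically closed `K'`
  set M : IntermediateField Kt Ω' := IntermediateField.adjoin Kt ({x₁} : Set Ω') with hM
  have hx₁M : x₁ ∈ M := IntermediateField.subset_adjoin _ _ rfl
  have hMdef : IsDefectlessField M (V'.comap (algebraMap M Ω')) := by
    refine hB Kt M (V'.comap (algebraMap M Ω')) ⟨x₁, hx₁M⟩ ?_ ?_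
    · intro n hn c h
      have h' : V'.valuation x₁ ^ n = V'.valuation ((c : Kt) : Ω') := by
        have h1 := congrArg (valueGroupHom M V') h
        rw [map_pow, valueGroupHom_valuation, valueGroupHom_valuation] at h1
        exact h1
      exact hx' n hn _ c.2 h'
    · apply IntermediateField.lift_injective M
      rw [IntermediateField.lift_adjoin, IntermediateField.lift_top, Set.image_singleton]
  -- `M` and `E'` have the same elements
  have hrange : Set.range (algebraMap Kt Ω') = (K' : Set Ω') := by
    ext y
    constructor
    · rintro ⟨w, rfl⟩; exact w.2
    · intro hy; exact ⟨⟨y, hy⟩, rfl⟩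
  have hME' : ∀ y : Ω', y ∈ M ↔ y ∈ E' := by
    intro y
    rw [← IntermediateField.mem_toSubfield, hM, IntermediateField.adjoin_toSubfield, hrange]
  let φ : M ≃+* E' :=
    { toFun := fun y => ⟨y, (hME' y).mp y.2⟩
      invFun := fun y => ⟨y, (hME' y).mpr y.2⟩
      left_inv := fun y => rfl
      right_inv := fun y => rfl
      map_mul' := fun _ _ => rfl
      map_add' := fun _ _ => rfl }
  have hφO : V'.comap (algebraMap M Ω') = (V'.comap (algebraMap E' Ω')).comap φ.toRingHom := by
    ext y; rfl
  have hE'def : IsSeparablyDefectlessField E' (V'.comap (algebraMap E' Ω')) :=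
    (IsDefectlessField.congr φ hφO hMdef).isSeparablyDefectlessField
  -- Step 5: `E' | E₁` is purely inseparable (generated over `E₁ = ι(E)` by `K'`)
  have hxE₁ : x₁ ∈ E.map ι := by rw [hE₁]; exact Subfield.subset_closure (Or.inr rfl)
  have hpi' : ∀ y ∈ E', ∃ n : ℕ, y ^ (ringExpChar Ω') ^ n ∈ E.map ι := by
    haveI : ExpChar (E.map ι) (ringExpChar Ω') := by
      rw [← ringExpChar_subfield_eq (E.map ι)]; exact ringExpChar.expChar _
    let N : IntermediateField (E.map ι) Ω' := IntermediateField.adjoin (E.map ι) (K' : Set Ω')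
    haveI hNpi : IsPurelyInseparable (E.map ι) N := by
      rw [IntermediateField.isPurelyInseparable_adjoin_iff_pow_mem (E.map ι) Ω' (ringExpChar Ω')]
      intro y hy
      obtain ⟨n, hn⟩ := hpi y hy
      have hmem : y ^ (ringExpChar Ω') ^ n ∈ E.map ι := by
        rw [hE₁]; exact Subfield.subset_closure (Or.inl hn)
      exact ⟨n, ⟨⟨y ^ (ringExpChar Ω') ^ n, hmem⟩, rfl⟩⟩
    -- `E' ≤ N`
    have hE'N : ∀ y ∈ E', y ∈ N := by
      have hle : E' ≤ N.toSubfield := by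
        rw [hE', Subfield.closure_le]
        rintro z (hz | hz)
        · exact IntermediateField.subset_adjoin _ _ hz
        · rw [Set.mem_singleton_iff] at hz
          subst hz
          exact N.algebraMap_mem ⟨_, hxE₁⟩
      exact fun y hy => hle hy
    intro y hy
    obtain ⟨n, ⟨z, hz⟩⟩ := IsPurelyInseparable.pow_mem (E.map ι) (ringExpChar Ω') (⟨y, hE'N y hy⟩ : N)
    refine ⟨n, ?_⟩
    have := congrArg (fun w : N => (w : Ω')) hz
    simp only [IntermediateField.coe_pow] at this
    change (z : Ω') = y ^ (ringExpChar Ω') ^ n at this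
    rw [← this]
    exact z.2
  -- Step 6: descent to the dense subfield `E₁ = ι(E)`
  have hE₁def : IsSeparablyDefectlessField (E.map ι) (V'.comap (algebraMap (E.map ι) Ω')) :=
    IsSeparablyDefectlessField.of_isDenseIn V' hEE' hpi' hdenseE hE'def
  -- Step 7: transport back along `E ≃ ι(E)`
  obtain ⟨e, he⟩ := exists_ringEquiv_map ι E
  refine IsSeparablyDefectlessField.congr e.symm ?_ hE₁def
  ext w
  simp only [ValuationSubring.mem_comap]
  rw [← hV', ValuationSubring.mem_comap]
  change (w : Ω') ∈ V' ↔ ι ((e.symm w : E) : Ω) ∈ V'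
  rw [← he (e.symm w), RingEquiv.apply_symm_apply]

/-- **The fact from the rank-one cases of (R4)**: composing with
`Kuhlmann2010StabilityAlgClosedValueTranscendental.of_rankOne'` (Lemmas 5.3–5.4 being proved):
`Kuhlmann2010SeparablyDefectlessRational_sepClosed` follows from
`Kuhlmann2010StabilityRankOneValueTranscendental` (DISCHARGED,
`Kuhlmann2010StabilityRankOneValueTranscendental_holds`) and
`Kuhlmann2010StabilityRankOneResidueTranscendental` — its remaining trust base.
[cite: Kuhlmann2010, Thm. 1.1 and Section 5 (Lemmas 5.3–5.4, p. 20)] -/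
theorem Kuhlmann2010SeparablyDefectlessRational_sepClosed.of_rankOneRT
    (h4r : Kuhlmann2010StabilityRankOneResidueTranscendental.{u}) :
    Kuhlmann2010SeparablyDefectlessRational_sepClosed.{u} :=
  Kuhlmann2010SeparablyDefectlessRational_sepClosed.of_algClosedVT
    (Kuhlmann2010StabilityAlgClosedValueTranscendental.of_rankOne'
      Kuhlmann2010StabilityRankOneValueTranscendental_holds h4r)

end Literature.AlgebraicGeometry.Resolution

end
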